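import Mathlib

/-!
rev 1.1 (2026-08-29T23:03Z): + §3a LAW (iii) finite model (graded Jacobi for the monad differential); §1–§5 unchanged.
rev 1.2 (2026-08-29T23:08Z): + §2b the trace codimension `h[k]` of ROW T (idea-crit-6 l.8742 price): factorisation ⇒ codim bound,
`h[k]` Künneth table (pure 1 ×4, mixed 4 ×6, Σ = 28 = h^{0,2}) vs the door of record = TARGET count 5572; nothing else changed.

# LINE 13 — the LETTER-TRACE LAW (plan-lens-HodgeAV-negation g12; crux `BlochSeedDiscOne` = stmt-HodgeConjecture-18881)

Kernel-checked finitary cores + arithmetic certificates of the idea card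
`Cruxes/BlochSeedDiscOne/Ideas/letter-trace-law.md`.  HC / HC_CM / HC_AV / `BlochSeedDiscOne` are NOT proved here or
anywhere in the tree; nothing below is a statement about a variety — it is linear algebra (§1–§3) and bookkeeping on the
census DESIGNS of record (§4).  Mathlib-only, 0 `sorry`, no instances, no notation.

## The law (informal; dictionary in the card)
Let `𝓔 = H(K)` be the middle cohomology of a finite letter complex `K` (two-term design `[𝓟 → 𝓝]`, monad `𝓐 → 𝓝 → 𝓒`,
display; ⊠-typed letters `L_x ⊗ U_x` with `U_x` holomorphically flat allowed), filtered by COLUMNS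
`F^p 𝓗om•(K,K) = ⊕_{j-i ≥ p} 𝓗om(K^i,K^j)`, with spectral sequence `E₁^{p,q} = H^q(𝓗om^p(K,K)) ⇒ Ext^{p+q}(𝓔,𝓔)`.
* LAW (i)  (positive columns are σ-invisible): `σ_q(F¹Ext²(𝓔,𝓔)) = 0` for every `q`, because `At(K) ∈ F⁰`
  (Čech components `At(K^i)` in column 0, `[∇,Φ]` in column +1), composition is filtered (`F^a ∘ F^b ⊂ F^{a+b}`) and the
  super-trace reads column 0 only.  Finite model: §1 (`trace (A^q * S) = 0` for `A` block-upper-triangular and `S`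
  STRICTLY block-upper-triangular w.r.t. the column index).
  ⇒ NECESSARY for I-semiregularity (any I):  `E_∞^{p,2-p} = 0` for all `p ≥ 1`  — ROW (1,1) and, for ≥ 3 terms, ROW (2,0).
* LAW (ii) (on column 0, σ reads only LETTER TRACES): for a column-0 class `η ⊗ M` (η ∈ H^{0,2}, M block-diagonal on
  the letters), `σ_q(η ⊗ M) = Σ_x ± η ∪ ch_q(L_x) · tr(M_xx)` — no connection term is needed on `F⁰`, and the
  TRACELESS part of every letter block is σ-invisible.  Finite model: §2.
  ⇒ ρ-DOOR: `dim F⁰Ext² ≤ h^{0,2} · ρ_I(D)`, `ρ_I(D) = rank{ch_I(L_x)}_x ≤ #distinct cells`;  and ROW T (with c4-1's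
  LEMMA Σ-DIAG survivors, §3 is the counting step): `h[k]·(S2 − c) ≤ L_k + L̄_k` for every `|k| = 2` — under (A3)/(A4)
  (leak-free live arrows) this is `S2 = c`: EVERY MULTIPLICITY `m_x = 1` and all door characters distinct.
* LAW (iii) (LOCALITY of the diagonal letter block, three-term case): for the diagonal cell `Diag_s = H²(𝓔𝓃𝒹 K^i_s)[k]`
  of ONE letter `s`, the conditions "extends to a total cocycle" and "is an eventual boundary" only involve blocks one
  or two LIVE steps away from `s` (one step: `Hom(A_a,N_s)`, `Hom(N_s,C_c)` resp. their reverses, in `H²[k]`; two steps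
  THROUGH `s`: `Hom(A_a,C_c)` in `H¹[k − e_g]` (outgoing `d₂`) and `Hom(C_c,A_a)` in `H³[k + e_g]` (incoming `d₂`);
  exact two-step sources contribute nothing by the graded Jacobi identity `[Φ,[Φ,e]] = [Φ²,e] = 0`, `Φ² = q∘i = 0`).
  This is monad-3's LEMMA Σ-H₃♯ (closure form `max_I [w(I) − w(Reach⁺I) − w(Src I)]`, memo cca56a9b7009eee1)
  evaluated at the singleton `I = {Diag_s[k]}`; ROW T replaces the door `5 572` by the trace codimension `h[k]`:
  per letter and multidegree, KILL iff `w_k(s) − h[k] − L_k(s) − L̄_k(s) − OUT_k(s) − IN_k(s) > 0` (§3b is the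
  counting step; §4b the digits on the monad designs of `hall3-table-g5.txt`, incl. the ⊠-typed room U4).
-/

set_option linter.dupNamespace false

namespace Summit.HodgeConjecture.HodgeConjecture.Cruxes.BlochSeedDiscOne.LetterTraceLaw

open Matrix

section ColumnFiltration
/-! ## §1  LAW (i), finite model: strictly block-upper-triangular matrices form an ideal in the block-upper-triangular
ones and have trace zero.  `b i` = the column (term index) of the basis vector `i`. -/

variable {ι R : Type*} [Fintype ι] [CommRing R]

/-- `S ∈ F¹`: the entry `S i j` vanishes unless the column strictly increases (`b i < b j`). -/
def StrictBlockTriangular (S : Matrix ι ι R) (b : ι → ℤ) : Prop := ∀ ⦃i j⦄, b j ≤ b i → S i j = 0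

omit [Fintype ι] in
theorem strictBlockTriangular_zero (b : ι → ℤ) : StrictBlockTriangular (0 : Matrix ι ι R) b :=
  fun _ _ _ => rfl

/-- `F⁰ · F¹ ⊂ F¹`. -/
theorem blockTriangular_mul_strict {A S : Matrix ι ι R} {b : ι → ℤ}
    (hA : Matrix.BlockTriangular A b) (hS : StrictBlockTriangular S b) :
    StrictBlockTriangular (A * S) b := by
  intro i j hij
  simp only [Matrix.mul_apply]
  apply Finset.sum_eq_zero
  intro k _
  by_cases hk : b k < b i
  · rw [hA hk, zero_mul]
  · rw [not_lt] at hk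
    rw [hS (le_trans hij hk), mul_zero]

/-- `F¹ · F⁰ ⊂ F¹`. -/
theorem strict_mul_blockTriangular {A S : Matrix ι ι R} {b : ι → ℤ}
    (hS : StrictBlockTriangular S b) (hA : Matrix.BlockTriangular A b) :
    StrictBlockTriangular (S * A) b := by
  intro i j hij
  simp only [Matrix.mul_apply]
  apply Finset.sum_eq_zero
  intro k _
  by_cases hk : b k ≤ b i
  · rw [hS hk, zero_mul]
  · rw [not_le] at hk
    rw [hA (lt_of_le_of_lt hij hk), mul_zero]

/-- The (super-)trace reads column 0 only: a strictly block-upper-triangular matrix has trace `0`. -/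
theorem trace_eq_zero_of_strict {S : Matrix ι ι R} {b : ι → ℤ} (hS : StrictBlockTriangular S b) :
    Matrix.trace S = 0 := by
  unfold Matrix.trace
  apply Finset.sum_eq_zero
  intro i _
  simp only [Matrix.diag_apply]
  exact hS (le_refl _)

/-- `A^q ∈ F⁰` for `A ∈ F⁰`. -/
theorem blockTriangular_pow {A : Matrix ι ι R} {b : ι → ℤ} [DecidableEq ι]
    (hA : Matrix.BlockTriangular A b) (q : ℕ) : Matrix.BlockTriangular (A ^ q) b := by
  induction q with
  | zero => simpa using Matrix.blockTriangular_one
  | succ n ih => rw [pow_succ]; exact ih.mul hA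

/-- LAW (i), finite model: for the Atiyah-type class `A ∈ F⁰` and any `S ∈ F¹`, every `tr(A^q ∘ S)` vanishes —
the semiregularity components `σ_q` kill the positive-column part `F¹Ext²`. -/
theorem trace_pow_mul_eq_zero {A S : Matrix ι ι R} {b : ι → ℤ} [DecidableEq ι]
    (hA : Matrix.BlockTriangular A b) (hS : StrictBlockTriangular S b) (q : ℕ) :
    Matrix.trace (A ^ q * S) = 0 :=
  trace_eq_zero_of_strict (blockTriangular_mul_strict (blockTriangular_pow hA q) hS)

/-- Same with the factors in the other order (`tr(S ∘ A^q) = 0`). -/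
theorem trace_mul_pow_eq_zero {A S : Matrix ι ι R} {b : ι → ℤ} [DecidableEq ι]
    (hA : Matrix.BlockTriangular A b) (hS : StrictBlockTriangular S b) (q : ℕ) :
    Matrix.trace (S * A ^ q) = 0 :=
  trace_eq_zero_of_strict (strict_mul_blockTriangular hS (blockTriangular_pow hA q))

end ColumnFiltration

section LetterTraces
/-! ## §2  LAW (ii), finite model: against a LETTER-SCALAR operator (the column-0 Atiyah class of a sum of line-bundle
letters, `At = ⊕_x c(L_x)·id` — also for flat-typed letters `L_x ⊗ U_x`, `At(U_x) = 0`), the trace pairing reads only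
the per-letter traces of `M`.  `ℓ i` = the letter of the basis vector `i`, `d` = the letter character. -/

variable {ι Λ R : Type*} [Fintype ι] [Fintype Λ] [DecidableEq ι] [DecidableEq Λ] [CommRing R]

/-- the letter trace of `M` at the letter `x`: the sum of the diagonal entries of `M` over the copies of `x`. -/
def letterTrace (ℓ : ι → Λ) (M : Matrix ι ι R) (x : Λ) : R := ∑ i, if ℓ i = x then M i i else 0

omit [Fintype Λ] [DecidableEq Λ] in
theorem trace_letterScalar_mul (d : Λ → R) (ℓ : ι → Λ) (M : Matrix ι ι R) :
    Matrix.trace (Matrix.diagonal (d ∘ ℓ) * M) = ∑ i, d (ℓ i) * M i i := by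
  unfold Matrix.trace
  apply Finset.sum_congr rfl
  intro i _
  simp [Matrix.diag_apply, Matrix.diagonal_mul]

/-- LAW (ii), finite model: `tr(diag(d ∘ ℓ) · M) = Σ_x d(x) · letterTrace(M, x)`. -/
theorem trace_letterScalar_mul_eq_sum_letterTrace (d : Λ → R) (ℓ : ι → Λ) (M : Matrix ι ι R) :
    Matrix.trace (Matrix.diagonal (d ∘ ℓ) * M) = ∑ x, d x * letterTrace ℓ M x := by
  rw [trace_letterScalar_mul]
  unfold letterTrace
  have : ∀ i, d (ℓ i) * M i i = ∑ x, (if ℓ i = x then d x * M i i else 0) := by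
    intro i
    rw [Finset.sum_ite_eq]; simp
  simp_rw [this]
  rw [Finset.sum_comm]
  apply Finset.sum_congr rfl
  intro x _
  rw [Finset.mul_sum]
  apply Finset.sum_congr rfl
  intro i _
  split_ifs <;> simp

/-- The traceless part of every letter block is σ-invisible on column 0: if all letter traces of `M` vanish then
`tr(diag(d ∘ ℓ) · M) = 0` for EVERY letter character `d` (every `q`, every `I`). -/
theorem trace_letterScalar_mul_eq_zero_of_letterTraceless (ℓ : ι → Λ) (M : Matrix ι ι R)
    (hM : ∀ x, letterTrace ℓ M x = 0) (d : Λ → R) :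
    Matrix.trace (Matrix.diagonal (d ∘ ℓ) * M) = 0 := by
  rw [trace_letterScalar_mul_eq_sum_letterTrace]
  simp [hM]

end LetterTraces

section TraceCodimension
/-! ## §2b  The trace codimension `h[k]` of ROW T (price of idea-crit-6 l.8742).  On the diagonal cell
`Diag_s[k] = H²(𝒪_X)[k] ⊗ Mat_{m_s}` (typed: `H^k(𝓔𝓃𝒹 U_s) ⊗ Mat_{m_s}`, `U_s` flat) EVERY component `σ_q` factors through the
LETTER TRACE `T_{s,k} = id ⊗ tr : Diag_s[k] → H²(𝒪_X)[k]` (LAW (ii): `σ_q(e) = ch_q(L_s) ∪ T_{s,k}(v)` for any lift `e ∈ F⁰Ext²` of a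
survivor `[v]`, the `F¹`/`B_∞` ambiguity being σ-invisible by LAW (i)).  Hence `codim (ker σ ∩ Surv_{s,k}) ≤ rank T_{s,k} ≤ h[k]` with
`h[k] := dim H²(𝒪_X)[k] = ∏_f h^{k_f}(𝒪_{E_f²})`, `(h⁰,h¹,h²)(𝒪_{E²}) = (1,2,1)` (c4-1 `ext2ub.coh_factor`, case `d = 0`): a SOURCE-side
bound, per multidegree, independent of which targets `H^{q+2}(Ω^q)[k+κ]` are reachable.  Table: `h[k] = 1` on the four pure `k`
(one `k_f = 2`), `h[k] = 4` on the six mixed `k` (two `k_f = 1`), `Σ_k h[k] = 28 = h^{0,2}(X)`; the door of record is the TARGET count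
`Σ_{q ≤ 3} h^{q,q+2}(X) = 28 + 448 + 1960 + 3136 = 5572` (`door_of_record`). -/

/-- Factorisation ⇒ kernel containment ⇒ codimension bound: if `σ = c ∘ T` with `T : V → H`, then
`dim V − dim H ≤ dim ker σ` (all `σ_q` at once: take `c` into the product of the targets). -/
theorem finrank_sub_le_finrank_ker_of_factor {K V H Z : Type*} [Field K] [AddCommGroup V] [Module K V]
    [AddCommGroup H] [Module K H] [AddCommGroup Z] [Module K Z] [FiniteDimensional K V] [FiniteDimensional K H]
    (T : V →ₗ[K] H) (c : H →ₗ[K] Z) :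
    Module.finrank K V - Module.finrank K H ≤ Module.finrank K (LinearMap.ker (c.comp T)) := by
  have hker : LinearMap.ker T ≤ LinearMap.ker (c.comp T) := by
    intro v hv; simp only [LinearMap.mem_ker] at hv ⊢; simp [hv]
  have h1 := Submodule.finrank_mono hker
  have h2 := LinearMap.finrank_range_add_finrank_ker T
  have h3 : Module.finrank K (LinearMap.range T) ≤ Module.finrank K H := Submodule.finrank_le _
  omega

/-- Inside a survivor subspace `S ≤ V`: the traceless survivors `S ⊓ ker T` have `dim ≥ dim S − dim H`. -/
theorem finrank_inf_ker_ge {K V H : Type*} [Field K] [AddCommGroup V] [Module K V]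
    [AddCommGroup H] [Module K H] [FiniteDimensional K V] [FiniteDimensional K H]
    (S : Submodule K V) (T : V →ₗ[K] H) :
    Module.finrank K S - Module.finrank K H ≤ Module.finrank K (S ⊓ LinearMap.ker T : Submodule K V) := by
  -- restrict T to S: ker (T ∘ S.subtype) ≅ S ⊓ ker T
  have hres := LinearMap.finrank_range_add_finrank_ker (T.comp S.subtype)
  have hrange : Module.finrank K (LinearMap.range (T.comp S.subtype)) ≤ Module.finrank K H := Submodule.finrank_le _
  have hmap : Module.finrank K (LinearMap.ker (T.comp S.subtype)) ≤ Module.finrank K (S ⊓ LinearMap.ker T : Submodule K V) := by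
    have : (LinearMap.ker (T.comp S.subtype)).map S.subtype ≤ S ⊓ LinearMap.ker T := by
      rintro v ⟨w, hw, rfl⟩
      simp only [Submodule.mem_inf, LinearMap.mem_ker]
      simp only [SetLike.mem_coe, LinearMap.mem_ker, LinearMap.coe_comp, Function.comp_apply] at hw
      exact ⟨w.2, hw⟩
    calc Module.finrank K (LinearMap.ker (T.comp S.subtype))
        = Module.finrank K ((LinearMap.ker (T.comp S.subtype)).map S.subtype) :=
          (LinearEquiv.finrank_eq (Submodule.equivMapOfInjective S.subtype S.injective_subtype
            (LinearMap.ker (T.comp S.subtype))))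
      _ ≤ _ := Submodule.finrank_mono this
  omega

/-- Künneth bookkeeping of `h[k]`: per-factor `(h⁰,h¹,h²)(𝒪_{E²}) = (1,2,1)`. -/
def hFactor : Fin 3 → ℕ := ![1, 2, 1]

/-- `h[k] = ∏_f h^{k_f}(𝒪)` for a multidegree `k : Fin 4 → Fin 3`. -/
def hK (k : Fin 4 → Fin 3) : ℕ := hFactor (k 0) * hFactor (k 1) * hFactor (k 2) * hFactor (k 3)

/-- The ten multidegrees with `|k| = 2`: four pure, six mixed. -/
def pureKs : List (Fin 4 → Fin 3) := [![2,0,0,0], ![0,2,0,0], ![0,0,2,0], ![0,0,0,2]]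
def mixedKs : List (Fin 4 → Fin 3) :=
  [![1,1,0,0], ![1,0,1,0], ![1,0,0,1], ![0,1,1,0], ![0,1,0,1], ![0,0,1,1]]

theorem hK_pure : ∀ k ∈ pureKs, hK k = 1 := by decide
theorem hK_mixed : ∀ k ∈ mixedKs, hK k = 4 := by decide
/-- every `|k| = 2` multidegree is in one of the two lists (so the table is complete). -/
theorem ks2_complete : ∀ k : Fin 4 → Fin 3, (k 0).val + (k 1).val + (k 2).val + (k 3).val = 2 →
    k ∈ pureKs ∨ k ∈ mixedKs := by decide
theorem sum_hK_eq_h02 : (pureKs.map hK).sum + (mixedKs.map hK).sum = 28 := by decide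
/-- `h^{0,2}` of the ambient = `C(8,2)`; the door of record counts TARGETS `Σ_{q≤3} C(8,q)·C(8,q+2)`. -/
theorem h02_eq_choose : Nat.choose 8 2 = 28 ∧
    Nat.choose 8 0 * Nat.choose 8 2 + Nat.choose 8 1 * Nat.choose 8 3 + Nat.choose 8 2 * Nat.choose 8 4
      + Nat.choose 8 3 * Nat.choose 8 5 = 5572 := by decide

/-- ROW T's replacement in one line: per cell the σ-codimension charged is `h[k] ≤ 4`, never the target count `5572`. -/
theorem hK_le_four : ∀ k : Fin 4 → Fin 3, (k 0).val + (k 1).val + (k 2).val + (k 3).val = 2 → hK k ≤ 4 := by decide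

end TraceCodimension

section Counting
/-! ## §3  The counting step of ROW T: survivors `S` (dim ≥ s) and the σ-invisible traceless classes `T` (codim ≤ c)
inside the diagonal block space `V` meet in dimension ≥ s − c; if σ is injective these must die in `E_∞`, whose
kernel from `S` has dimension ≤ L̄.  Pure linear algebra (Grassmann's formula). -/

variable {K V : Type*} [DivisionRing K] [AddCommGroup V] [Module K V] [FiniteDimensional K V]

theorem finrank_add_le_finrank_add_finrank_inf (S T : Submodule K V) :
    Module.finrank K S + Module.finrank K T ≤ Module.finrank K V + Module.finrank K ↥(S ⊓ T) := by
  have h := Submodule.finrank_sup_add_finrank_inf_eq S T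
  have h' : Module.finrank K ↥(S ⊔ T) ≤ Module.finrank K V := Submodule.finrank_le _
  omega

/-- ROW T in numbers: if `dim S ≥ w − L`, `dim T ≥ w − hc` inside `V` of dimension `w`, and `S ⊓ T` has dimension
`≤ L̄` (it must map to zero in `E_∞` under an injective σ), then `w − hc ≤ L + L̄`, i.e. `h·(S2 − c) ≤ L + L̄`. -/
theorem rowT_inequality (S T : Submodule K V) (w L Lbar hc : ℕ)
    (hV : Module.finrank K V = w) (hS : w - L ≤ Module.finrank K S) (hT : w - hc ≤ Module.finrank K T)
    (hST : Module.finrank K ↥(S ⊓ T) ≤ Lbar) (hLw : L ≤ w) (hcw : hc ≤ w) : w - hc ≤ L + Lbar := by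
  have h := finrank_add_le_finrank_add_finrank_inf S T
  omega

end Counting

section Locality
/-! ## §3a  LAW (iii), finite model of the graded-Jacobi step.  For the total differential `Φ` of a letter complex
(`Φ·Φ = 0`; for a monad `A —i→ N —q→ C` this is `q ∘ i = 0`, see `monadDifferential_mul_self_eq_zero`) and an EVEN
(column-0) cochain `e`, the graded double commutator `[Φ,[Φ,e]] = Φ·[Φ,e] + [Φ,e]·Φ` equals `[Φ², e]`, hence vanishes:
the would-be EXACT two-step sources/targets of the `(0,2)` bookkeeping are identically zero, so only LIVE two-step
composites through the letter (the OUT/IN terms of ROW T) and one-step live blocks (L/L̄) enter — monad-3's Σ-H₃♯ closure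
form at the singleton `I = {Diag_s[k]}` (memo cca56a9b §2). -/

theorem graded_jacobi_eq_comm_sq {R : Type*} [Ring R] (Φ e : R) :
    Φ * (Φ * e - e * Φ) + (Φ * e - e * Φ) * Φ = Φ ^ 2 * e - e * Φ ^ 2 := by
  noncomm_ring

theorem graded_jacobi_eq_zero_of_sq_eq_zero {R : Type*} [Ring R] (Φ e : R) (hΦ : Φ ^ 2 = 0) :
    Φ * (Φ * e - e * Φ) + (Φ * e - e * Φ) * Φ = 0 := by
  rw [graded_jacobi_eq_comm_sq, hΦ]; simp

/-- The total differential of a monad `A —i→ N —q→ C` as a block matrix on `(a ⊕ n) ⊕ c` (columns = source). -/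
def monadDifferential {K : Type*} [Field K] {a n c : Type*}
    (i : Matrix n a K) (q : Matrix c n K) : Matrix ((a ⊕ n) ⊕ c) ((a ⊕ n) ⊕ c) K :=
  Matrix.fromBlocks (Matrix.fromBlocks 0 0 i 0) 0 (Matrix.fromCols 0 q) 0

/-- `q ∘ i = 0` ⇒ the total differential squares to zero, so `graded_jacobi_eq_zero_of_sq_eq_zero` applies to it. -/
theorem monadDifferential_mul_self_eq_zero {K : Type*} [Field K] {a n c : Type*} [Fintype a] [Fintype n] [Fintype c]
    (i : Matrix n a K) (q : Matrix c n K) (hqi : q * i = 0) :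
    monadDifferential i q * monadDifferential i q = 0 := by
  rw [monadDifferential, Matrix.fromBlocks_multiply]
  have h1 : Matrix.fromCols (0 : Matrix c a K) q * Matrix.fromBlocks (0 : Matrix a a K) (0 : Matrix a n K) i (0 : Matrix n n K)
      = 0 := by
    rw [Matrix.fromCols_mul_fromBlocks]; simp [hqi]
  simp [h1, Matrix.fromBlocks_multiply]

/-- With decidable indices the matrix ring has powers: `Φ ^ 2 = 0`, the hypothesis of the Jacobi lemma verbatim. -/
theorem monadDifferential_sq_eq_zero {K : Type*} [Field K] {a n c : Type*} [Fintype a] [Fintype n] [Fintype c]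
    [DecidableEq a] [DecidableEq n] [DecidableEq c]
    (i : Matrix n a K) (q : Matrix c n K) (hqi : q * i = 0) :
    monadDifferential i q ^ 2 = 0 := by
  rw [sq]; exact monadDifferential_mul_self_eq_zero i q hqi

/-- Hence for every column-0 cochain `e` of the monad: `[Φ,[Φ,e]]_graded = 0`. -/
theorem monad_graded_jacobi_eq_zero {K : Type*} [Field K] {a n c : Type*} [Fintype a] [Fintype n] [Fintype c]
    [DecidableEq a] [DecidableEq n] [DecidableEq c]
    (i : Matrix n a K) (q : Matrix c n K) (hqi : q * i = 0) (e : Matrix ((a ⊕ n) ⊕ c) ((a ⊕ n) ⊕ c) K) :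
    monadDifferential i q * (monadDifferential i q * e - e * monadDifferential i q)
      + (monadDifferential i q * e - e * monadDifferential i q) * monadDifferential i q = 0 :=
  graded_jacobi_eq_zero_of_sq_eq_zero _ e (monadDifferential_sq_eq_zero i q hqi)

end Locality

section MonadCounting
/-! ## §3b  The counting step of the per-letter monad ROW T (three-term letter complexes).  Inside the diagonal cell
`V = Diag_s[k]` (dimension `w`): `S` = classes whose `d₁` vanishes (codim ≤ `L`, the one-step targets), `T` = the
traceless classes (codim ≤ `h`), `f` = the outgoing `d₂` on `S ⊓ T` (its image lies in the through-`s` two-step targets,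
dimension ≤ `OUT`), `B` = eventual boundaries meeting the cell (dimension ≤ `L̄ + IN`: one-step sources and through-`s`
two-step sources).  Then at least `w − h − L − OUT − L̄ − IN` independent classes of `E_∞^{0,2} ⊂ Ext²` are traceless on
column 0, hence in `ker σ_q` for every `q` by LAW (i)+(ii).  Pure linear algebra. -/

variable {K V W : Type*} [DivisionRing K] [AddCommGroup V] [Module K V] [FiniteDimensional K V]
  [AddCommGroup W] [Module K W]

/-- restricted rank–nullity: the part of `U` killed by `f` has dimension ≥ `dim U − dim f(U)`. -/
theorem finrank_sub_finrank_map_le_finrank_inf_ker (U : Submodule K V) (f : V →ₗ[K] W) :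
    Module.finrank K U - Module.finrank K ↥(U.map f) ≤ Module.finrank K ↥(U ⊓ LinearMap.ker f) := by
  have h := LinearMap.finrank_range_add_finrank_ker (f.comp U.subtype)
  have hr : LinearMap.range (f.comp U.subtype) = U.map f := by
    rw [LinearMap.range_comp, Submodule.range_subtype]
  have hk : Module.finrank K ↥(LinearMap.ker (f.comp U.subtype)) = Module.finrank K ↥(U ⊓ LinearMap.ker f) := by
    rw [← Submodule.finrank_map_subtype_eq U (LinearMap.ker (f.comp U.subtype)), LinearMap.ker_comp,
      Submodule.map_comap_subtype]
  rw [hr, hk] at h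
  omega

/-- passing to the quotient by the boundaries `B` costs at most `dim B`. -/
theorem finrank_sub_finrank_le_finrank_map_mkQ (U B : Submodule K V) :
    Module.finrank K U - Module.finrank K B ≤ Module.finrank K ↥(U.map B.mkQ) := by
  have h := LinearMap.finrank_range_add_finrank_ker (B.mkQ.comp U.subtype)
  have hr : LinearMap.range (B.mkQ.comp U.subtype) = U.map B.mkQ := by
    rw [LinearMap.range_comp, Submodule.range_subtype]
  have hk : Module.finrank K ↥(LinearMap.ker (B.mkQ.comp U.subtype)) ≤ Module.finrank K B := by
    rw [← Submodule.finrank_map_subtype_eq U (LinearMap.ker (B.mkQ.comp U.subtype)), LinearMap.ker_comp,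
      Submodule.ker_mkQ, Submodule.map_comap_subtype]
    exact Submodule.finrank_mono inf_le_right
  rw [hr] at h
  omega

/-- per-letter monad ROW T, counting step: `w − h − L − OUT − L̄ − IN` traceless survivors in `E_∞^{0,2}`. -/
theorem rowT_monad_survivors (S T B : Submodule K V) (f : V →ₗ[K] W) (w h L OUT Lbar IN : ℕ)
    (hV : Module.finrank K V = w) (hS : w - L ≤ Module.finrank K S) (hT : w - h ≤ Module.finrank K T)
    (hf : Module.finrank K ↥((S ⊓ T).map f) ≤ OUT) (hB : Module.finrank K B ≤ Lbar + IN) :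
    w - h - L - OUT - Lbar - IN ≤ Module.finrank K ↥(((S ⊓ T) ⊓ LinearMap.ker f).map B.mkQ) := by
  have h1 := finrank_add_le_finrank_add_finrank_inf S T
  have h2 := finrank_sub_finrank_map_le_finrank_inf_ker (S ⊓ T) f
  have h3 := finrank_sub_finrank_le_finrank_map_mkQ ((S ⊓ T) ⊓ LinearMap.ker f) B
  have h4 : Module.finrank K S ≤ Module.finrank K V := Submodule.finrank_le S
  have h5 : Module.finrank K T ≤ Module.finrank K V := Submodule.finrank_le T
  omega

end MonadCounting

section Certificates
/-! ## §4  Arithmetic certificates on census rows of record (digits: gs-eng-2 g58 EXT2GEN bus l.8337 ×2 crit-hsem-2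
l.8260 — a1a8405d generic-φ block ranks; c4-1 g5 `sigmafloor.py`/`ext2ub.py --kdeg`/`hall3-table-g5.txt`; this seat's
`line13/lettertrace.py`, `line13/tracelessrow.py`).  Each is a closed numeral identity/inequality. -/

/-- Hodge numbers of the 8-fold `X = Π_f E_f × E_f'`: the door of record `Σ_{q ≤ 3} h^{q+2,q} = 5 572`. -/
theorem door_of_record : 28 + 448 + 1960 + 3136 = 5572 := by norm_num

/-- a1a8405d (TW32b-p32-sharp), ROW (1,1) at generic φ: `E₂^{1,1} = 4·3 726`, `E₂^{-1,2} = 6·408 + 4·12`, so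
`dim E_∞^{1,1} ≥ E₂^{1,1} − E₂^{-1,2} = 12 408 > 0` ⊂ ker σ: dead for every I with NO door budget used. -/
theorem a1a8405d_row11 : 4 * 3726 = 14904 ∧ 6 * 408 + 4 * 12 = 2496 ∧ 14904 - 2496 = 12408 ∧ 0 < 12408 := by
  norm_num

/-- a1a8405d, ρ-door: `dim E_∞^{0,2} = 25 726` (l.8337) exceeds `h^{0,2}·ρ_I ≤ 28·65` (65 distinct cells). -/
theorem a1a8405d_rhoDoor : 28 * 65 = 1820 ∧ 1820 < 25726 := by norm_num

/-- a1a8405d, ROW (1,1) at the φ-FREE E₁ level is vacuous: column +1 Morse `4·(8 208 − 6 960) + 8 = 5 000` does not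
exceed the d₂ budget `E₁^{-1,2} = 15 168` (honest: the kill needs the E₂ digits above). -/
theorem a1a8405d_row11_E1_vacuous : 4 * (8208 - 6960) + 8 = 5000 ∧ 5000 ≤ 15168 := by norm_num

/-- ROW T (traceless-diagonal row), φ-free and door-free, `h[k]·(S2 − c) − L_k − L̄_k > 0` at a pure `k`:
a009d00f / 4545dca3 / d3cd3db7 (TW32b-p8-tau, -rb, -flip): `(896 − 65) − 676 − 12 = 143`. -/
theorem rowT_a009d00f : (896 - 65) - 676 - 12 = 143 ∧ 0 < 143 := by norm_num

/-- ROW T: 98386e74 (TW32b-p8-hub3) `(1468 − 65) − 1220 − 12 = 171`; 64b6d3fe (hub4) `(1396 − 65) − 1188 − 12 = 131`;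
e238c888 (TW32b-plain) `(1216 − 65) − 1060 − 12 = 79`. -/
theorem rowT_hub3_hub4_plain :
    (1468 - 65) - 1220 - 12 = 171 ∧ (1396 - 65) - 1188 - 12 = 131 ∧ (1216 - 65) - 1060 - 12 = 79 := by norm_num

/-- ROW T: 3c2b814d (TW18x120-classblind), mixed `k`: `4·(1 330 224 − 192) − 3 763 008 − 547 776 = 1 009 344`. -/
theorem rowT_TW18x120 : 4 * (1330224 - 192) - 3763008 - 547776 = 1009344 := by norm_num

/-- ROW T is VACUOUS where it should be: a1a8405d (`S2 = 160`, 65 cells, pure k: `95 − 420 − 12 < 0`, recorded as the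
truncated subtraction `95 - 432 = 0`), RB16-plain (`320 − 65 = 255` vs `L + L̄ ≥ 1 808`). -/
theorem rowT_vacuous_a1a8405d_RB16 : (160 - 65) - 432 = 0 ∧ (320 - 65) - 1808 = 0 := by norm_num

/-- Honest vacuity of the φ-free positive-column rows on the live ⊠-room U4 (bd78f9c7 × typing c2464ca5, this seat's
`lettertrace.py`): `hom(A,C) = 74 449 384 797 363 525 504` is below the d₁ budget `E₁^{1,0}` alone. -/
theorem U4_row20_E1_vacuous : (74449384797363525504 : ℕ) < 213226850153781631792 := by norm_num

/-- … and on the small monads of `hall3-table-g5.txt` (S131 D2 7faf2819: `hom(A,C) = 32` vs budgets `10 352`;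
B8 9c14f93a: `1 024` vs `10 240`; B5 c3b68296: `1 920` vs `13 320`). -/
theorem smallMonads_row20_E1_vacuous : 32 < 10352 ∧ 1024 < 10240 ∧ 1920 < 13320 := by norm_num

/-- The universal ρ-door gives nothing beyond the door of record: per `q` the letter-character spans have dimension
≤ (1, 16, 100, 304) and `28·16 = 448 = h^{3,1}`, `28·100 ≥ 1 960`, `28·304 ≥ 3 136` — the gain is design-specific
(`ρ_I(D) ≤ #cells`), e.g. `28·65 = 1 820`, `28·49 = 1 372`. -/
theorem rhoDoor_universal_no_gain :
    28 * 16 = 448 ∧ 1960 ≤ 28 * 100 ∧ 3136 ≤ 28 * 304 ∧ 28 * 65 = 1820 ∧ 28 * 49 = 1372 := by norm_num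

/-! ## §4b  Per-letter ROW T digits on the monad designs of `hall3-table-g5.txt` and the two-term per-letter digits
(this seat's `line-13/code/rowt_monad.py` 0c3955a95bf2adc2 on c4-1's loaders `hallrank3t`/`u4typing` v2/`ext2ub`/
`c4lift`; logs `line-13/logs/rowt-monad-U4-typed-v2.log` a486967e15801c4a, `rowt-monad-classblind.log` 9183a6d833bf496d,
`rowt-twoterm.log`).  Each line: `w_k(s) − h[k] − L_k(s) − L̄_k(s) − OUT_k(s) − IN_k(s)`. -/

/-- U4 (16·bd78f9c7, ⊠-typing c2464ca5, RHO LAW): the typed N-class ((8,−4,0),(11,0,1),(12,0,0),(12,0,0)) of type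
Atl₁²⊠Atl_i²⊠O⊠O, `m = 706 780`, `k = (0,0,1,1)`: `w = m²·(2·2·2·2)`, one-step targets `180 935 680`, no live
out-arrow (so no two-step target or source through `s`).  Σ-H₃♯ ≥ the singleton value `7 992 426 558 720 > 5 572`
(door version) and ROW T has `7 992 426 558 716` traceless survivors (door-free version). -/
theorem U4_singleton :
    706780 ^ 2 * (2 * 2 * 2 * 2) = 7992607494400 ∧
    7992607494400 - 180935680 - 0 - 0 - 0 = 7992426558720 ∧ 5572 < 7992426558720 ∧
    7992607494400 - 4 - 180935680 - 0 - 0 - 0 = 7992426558716 := by norm_num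

/-- U4, the same cell over all ten multidegrees: `Σ_k F_k = 55 942 643 454 720`. -/
theorem U4_singleton_all_k :
    4 * 1998106639680 + 5 * 7992426558720 + 7988084102400 = 55942643454720 ∧
    706780 ^ 2 * 4 - 45233920 = 1998106639680 ∧ 706780 ^ 2 * 16 - 4432924160 - 90467840 = 7988084102400 := by
  norm_num

/-- bd78f9c7 class-blind (U4's base; c4-1 coarse Σ-H₃ VACUOUS): N-cell ((11,−1,0)³,(12,0,0)), `m = 435 462`,
`k = 0011`: `758 508 613 776 − 122 909 149 500 − 52 674 354 444 − 0 − 0 = 582 925 109 832 > 5 572`. -/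
theorem bd78f9c7_singleton :
    435462 ^ 2 * 4 = 758508613776 ∧ 758508613776 - 122909149500 - 52674354444 = 582925109832 ∧
    5572 < 582925109832 := by norm_num

/-- D2-S131 7faf2819 (j334569): hub N (16,0,0)⁴, `m = 8`.  Pure `k`: `64 − 1 − 0 − 0 − 0 − 0 = 63 > 0` ⇒ ROW T kills
door-free, while the door version is consistent with monad-3's certified-exhausted column-0 optimum:
singleton `Σ_k F_k = 4·64 = 256 ≤ 640 < 5 572` (mixed `k`: `w = 256 = L`). -/
theorem D2_S131_hub_singleton :
    8 ^ 2 * 1 - 1 - 0 - 0 - 0 - 0 = 63 ∧ 0 < 63 ∧ 8 ^ 2 * 4 - 256 = 0 ∧ 4 * (8 ^ 2 * 1) = 256 ∧ 256 ≤ 640 ∧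
    640 < 5572 := by norm_num

/-- 4621331e (B2SURV PORT ×12; coarse VACUOUS, ♯ DEAD 67 773 694 912): hub N (12,0,0)⁴, `m = 8 928`, `k = 0011`:
`318 836 736 − 4 − 135 277 056 − 11 856 384 − 912 384 − 709 632 = 170 081 276`, below monad-3's optimum as it must be. -/
theorem m4621331e_hub_singleton :
    8928 ^ 2 * 4 = 318836736 ∧ 318836736 - 4 - 135277056 - 11856384 - 912384 - 709632 = 170081276 ∧
    170081276 ≤ 67773694912 := by norm_num

/-- 28a59186 / ccef7e0e / c7df628f (already DEAD by Σ-H₃): best singletons `574 564 − 1 − 0 − 108 394 = 466 169` and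
`36 864 − 4 − 0 − 0 = 36 860` — extra door-free certificates. -/
theorem B2SURV_singletons :
    758 ^ 2 * 1 - 1 - 0 - 108394 - 0 - 0 = 466169 ∧ 96 ^ 2 * 4 - 4 - 0 - 0 - 0 - 0 = 36860 := by norm_num

/-- Honest VACUITY of the per-letter row: S84-A0 08162ddb (c4-1: not run), best C-cell `m = 262`:
`68 644 − 1 − 0 − 0 − 42 444 − 28 296 < 0` (recorded as a truncated subtraction); B5/B7/B8: no letter with a positive
pre-margin (their ♯-kills come from the `H^{−1,3}` piece, not from column 0 singletons). -/
theorem S84_singleton_vacuous : 262 ^ 2 * 1 = 68644 ∧ 68644 - 1 - 0 - 0 - 42444 - 28296 = 0 := by norm_num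

/-- Two-term per-letter ROW T (`OUT = IN = 0`): killing letters of record `h[k](m² − 1) − (L_k(s) + L̄_k(s))`:
hub3 98386e74 `m = 37`: `1 368 − 1 184 = 184`; hub4 64b6d3fe `m = 36`: `143`; p8-tau a009d00f `m = 20`: `79`;
TW32a-plain 933a4d2f `m = 3`, mixed k: `4·8 − 12 = 20`; TW18x120 3c2b814d `m = 255`: `137 696`;
EXT20 INTDESIGNs (bc5-plan g14 `work/g14/in/ext20`) 7bd477dd `m = 228`: `175 100`, 5f28f0cf `m = 144`: `58 748`,
7c72b16c `m = 292`: `58 396`, 86269184 `m = 263`: `203 032`. -/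
theorem twoTerm_perLetter_kills :
    1 * (37 ^ 2 - 1) - 1184 = 184 ∧ 1 * (36 ^ 2 - 1) - 1152 = 143 ∧ 1 * (20 ^ 2 - 1) - 320 = 79 ∧
    4 * (3 ^ 2 - 1) - 12 = 20 ∧ 4 * (255 ^ 2 - 1) - 122400 = 137696 ∧ 4 * (228 ^ 2 - 1) - 32832 = 175100 ∧
    4 * (144 ^ 2 - 1) - 24192 = 58748 ∧ 4 * (292 ^ 2 - 1) - 282656 = 58396 ∧
    4 * (263 ^ 2 - 1) - 73640 = 203032 := by norm_num

end Certificates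

section Rows
/-! ## §5  The rows as typed predicates on an E₁/E₂ digit table (documentation of what the instruments test). -/

/-- digits of a letter complex: `E p q` = dim `E_r^{p,q}` at the page the instrument works on. -/
structure PageTable where
  E : ℤ → ℤ → ℕ

/-- ROW (2,0) (three or more terms): a positive margin certifies `E_∞^{2,0} ≠ 0 ⊂ ker σ`. -/
def Row20Kills (T : PageTable) : Prop := T.E 1 0 + T.E 0 1 + T.E (-1) 2 + T.E (-2) 3 < T.E 2 0

/-- ROW (1,1): a positive margin certifies `E_∞^{1,1} ≠ 0 ⊂ ker σ` (two-term: only the `E (-1) 2` budget). -/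
def Row11Kills (T : PageTable) : Prop := T.E 0 1 + T.E 2 1 + T.E (-1) 2 + T.E (-2) 3 < T.E 1 1

/-- digits of ONE diagonal letter cell at one multidegree: weight, trace codimension, one-step out/in, two-step out/in. -/
structure LetterCell where
  w : ℕ
  h : ℕ
  L : ℕ
  Lbar : ℕ
  OUT : ℕ
  IN : ℕ

/-- per-letter ROW T (door-free): a positive margin certifies traceless survivors in `E_∞^{0,2} ∩ ker σ`. -/
def RowTKills (c : LetterCell) : Prop := c.h + c.L + c.Lbar + c.OUT + c.IN < c.w

/-- the door version (LAW (iii) alone = Σ-H₃♯ on a singleton): survivors exceed the door of record. -/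
def SingletonDoorKills (c : LetterCell) : Prop := 5572 + c.L + c.Lbar + c.OUT + c.IN < c.w

theorem U4_cell_kills : RowTKills ⟨7992607494400, 4, 180935680, 0, 0, 0⟩ ∧
    SingletonDoorKills ⟨7992607494400, 4, 180935680, 0, 0, 0⟩ := by
  unfold RowTKills SingletonDoorKills; norm_num

theorem D2_hub_kills_doorfree_only : RowTKills ⟨64, 1, 0, 0, 0, 0⟩ ∧ ¬ SingletonDoorKills ⟨64, 1, 0, 0, 0, 0⟩ := by
  unfold RowTKills SingletonDoorKills; norm_num

/-- a1a8405d at E₂ (generic φ): the table of l.8337 kills by ROW (1,1). -/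
theorem a1a8405d_E2_row11Kills :
    Row11Kills ⟨fun p q => if p = 1 ∧ q = 1 then 14904 else if p = -1 ∧ q = 2 then 2496 else 0⟩ := by
  unfold Row11Kills; norm_num

end Rows

end Summit.HodgeConjecture.HodgeConjecture.Cruxes.BlochSeedDiscOne.LetterTraceLaw
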